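import Summits.QuantumFields.YangMills.Theorems.BalabanLadderNTStrongCouplingAnalyticJet
import HarnessLib

/-!
# Crux `NT` (stmt-QuantumFields-19353), LINE φ §FH at strong coupling: the analytic jet lemma at EVERY ORDER — a bounded holomorphic
# function on a disc whose real part has a real two-sided jet `c tᵏ + O(tᵏ⁺¹)` has real-axis derivative `k c tᵏ⁻¹ + O(tᵏ)`

Fleet lead prover of crux `NT` (unit `ym-spine-19353-p1`, g24).  `…StrongCouplingAnalyticJet.re_deriv_jet` is the order-`8` instance used by
the mirror pair (tube of eight faces); this file proves the same statement at every order `k`, so that every strong-coupling jet of the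
tree (the cube skewness `β³`, longer tubes `β^{8n}`, …) differentiates in the coupling the same way:

* **`re_deriv_jet_pow`** — `f` holomorphic on `ball 0 R`, `‖f‖ ≤ M` there, `|Re f(t) − c tᵏ| ≤ K tᵏ⁺¹` for `0 < t ≤ δ` (every `k : ℕ`) ⇒
  `|Re f'(t) − k c tᵏ⁻¹| ≤ (2ᵏ⁺² M/(R/2)ᵏ⁺¹) tᵏ` for `0 < t ≤ R/8`.

Proof as at order 8: Cauchy tail of the Taylor polynomial of degree `k` (`AnalyticJet.taylor_tail`), identification of the real parts of
its coefficients from the real jet (`AnalyticJet.coeff_eq_zero_of_abs_sum_le`), Cauchy's estimate for the tail's derivative on the circle of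
radius `t` about `t` (`AnalyticJet.norm_deriv_tail_le`).  Mathlib + the tree's `AnalyticJet`; THEOREMS ONLY; no `sorry`.  HONEST FRAMING:
textbook complex analysis; nothing about Yang–Mills is proved in this file.  `--supports stmt-QuantumFields-19353`. [folklore]
-/

set_option autoImplicit false

noncomputable section

open MeasureTheory Filter Topology Asymptotics Finset Complex Metric
open scoped BigOperators NNReal ENNReal

namespace Summit.QuantumFields.YangMills.Cruxes.NT.StrongCouplingRung.AnalyticJet

/-- **Real-axis derivative jet at every order.**  If `f` is holomorphic on `ball 0 R` with `‖f‖ ≤ M` there and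
`|Re f(t) − c tᵏ| ≤ K tᵏ⁺¹` for `0 < t ≤ δ` (any `k`; for `k = 0` read `t⁻¹ := t⁰`, the claim is then Cauchy's bound), then
`|Re f'(t) − k c tᵏ⁻¹| ≤ (2ᵏ⁺² M /(R/2)ᵏ⁺¹) tᵏ` for `0 < t ≤ R/8`. [folklore] -/
theorem re_deriv_jet_pow {f : ℂ → ℂ} {R M c K δ : ℝ} (k : ℕ) (hR : 0 < R) (hδ : 0 < δ)
    (hf : DifferentiableOn ℂ f (ball 0 R)) (hM : ∀ z ∈ ball (0 : ℂ) R, ‖f z‖ ≤ M)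
    (hjet : ∀ t : ℝ, 0 < t → t ≤ δ → |(f t).re - c * t ^ k| ≤ K * t ^ (k + 1)) :
    ∀ t : ℝ, 0 < t → t ≤ R / 8 →
      |(deriv f t).re - k * c * t ^ (k - 1)| ≤ 2 ^ (k + 2) * M / (R / 2) ^ (k + 1) * t ^ k := by
  obtain ⟨a, ha, htail⟩ := taylor_tail f hR hf hM (k + 1)
  have hM0 : 0 ≤ M := (norm_nonneg _).trans (hM 0 (mem_ball_self hR))
  set P : ℂ → ℂ := fun z => ∑ n ∈ Finset.range (k + 1), a n * z ^ n with hP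
  -- real part of `P` on the real axis
  have hPre : ∀ t : ℝ, (P t).re = ∑ n ∈ Finset.range (k + 1), (a n).re * t ^ n := by
    intro t
    rw [hP, Complex.re_sum]
    refine Finset.sum_congr rfl fun n _ => ?_
    rw [← Complex.ofReal_pow, Complex.re_mul_ofReal]
  -- (i) identification of the real parts of the coefficients
  set b : ℕ → ℝ := fun n => (a n).re - if n = k then c else 0 with hb
  have hbsum : ∀ t : ℝ, ∑ n ∈ Finset.range (k + 1), b n * t ^ n =
      (∑ n ∈ Finset.range (k + 1), (a n).re * t ^ n) - c * t ^ k := by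
    intro t
    simp only [hb, sub_mul, Finset.sum_sub_distrib, ite_mul, zero_mul]
    rw [Finset.sum_ite_eq' (Finset.range (k + 1)) k (fun n => c * t ^ n)]
    simp
  have hδ' : 0 < min δ (R / 4) := lt_min hδ (by positivity)
  have hbz : ∀ n, n < k + 1 → b n = 0 := by
    intro n hn
    refine coeff_eq_zero_of_abs_sum_le (k + 1) (k + 1) b (K + 2 * M / (R / 2) ^ (k + 1)) (min δ (R / 4)) hδ'
      (fun t ht htδ => ?_) n hn hn
    rw [hbsum]
    have h1 := hjet t ht (htδ.trans (min_le_left _ _))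
    have h2 := htail (t : ℂ) (by rw [Complex.norm_real, Real.norm_eq_abs, abs_of_pos ht]; exact htδ.trans (min_le_right _ _))
    have h3 : |(f t).re - ∑ n ∈ Finset.range (k + 1), (a n).re * t ^ n| ≤ 2 * M * (t / (R / 2)) ^ (k + 1) := by
      rw [← hPre, ← Complex.sub_re]
      refine (Complex.abs_re_le_norm _).trans ?_
      rw [Complex.norm_real, Real.norm_eq_abs, abs_of_pos ht] at h2
      exact h2
    have h4 : 2 * M * (t / (R / 2)) ^ (k + 1) = 2 * M / (R / 2) ^ (k + 1) * t ^ (k + 1) := by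
      rw [div_pow]; ring
    rw [h4] at h3
    have := abs_sub_le (∑ n ∈ Finset.range (k + 1), (a n).re * t ^ n) (f ↑t).re (c * t ^ k)
    rw [abs_sub_comm] at h3
    calc |∑ n ∈ Finset.range (k + 1), (a n).re * t ^ n - c * t ^ k|
        ≤ |∑ n ∈ Finset.range (k + 1), (a n).re * t ^ n - (f ↑t).re| + |(f ↑t).re - c * t ^ k| := this
      _ ≤ 2 * M / (R / 2) ^ (k + 1) * t ^ (k + 1) + K * t ^ (k + 1) := add_le_add h3 h1
      _ = (K + 2 * M / (R / 2) ^ (k + 1)) * t ^ (k + 1) := by ring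
  have hare : ∀ n, n < k + 1 → (a n).re = if n = k then c else 0 := fun n hn => by
    have := hbz n hn; rw [hb] at this; linarith
  -- (ii) derivative of `P`
  intro t ht htR
  have hPd : HasDerivAt P (∑ n ∈ Finset.range (k + 1), a n * ((n : ℂ) * (t : ℂ) ^ (n - 1))) t := by
    rw [hP]
    exact HasDerivAt.fun_sum fun n _ => (hasDerivAt_pow n (t : ℂ)).const_mul (a n)
  have hPd_re : (∑ n ∈ Finset.range (k + 1), a n * ((n : ℂ) * (t : ℂ) ^ (n - 1))).re = k * c * t ^ (k - 1) := by
    rw [Complex.re_sum]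
    have hterm : ∀ n ∈ Finset.range (k + 1), (a n * ((n : ℂ) * (t : ℂ) ^ (n - 1))).re =
        (if n = k then c else 0) * (n * t ^ (n - 1)) := by
      intro n hn
      rw [← hare n (Finset.mem_range.1 hn)]
      have : ((n : ℂ) * (t : ℂ) ^ (n - 1)) = ((n * t ^ (n - 1) : ℝ) : ℂ) := by push_cast; ring
      rw [this, Complex.re_mul_ofReal]
    rw [Finset.sum_congr rfl hterm]
    simp only [ite_mul, zero_mul]
    rw [Finset.sum_ite_eq' (Finset.range (k + 1)) k, if_pos (Finset.mem_range.2 (Nat.lt_succ_self k))]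
    ring
  -- (iii) the tail and its derivative
  set Q : ℂ → ℂ := fun z => f z - P z with hQ
  have hPdiff : Differentiable ℂ P := by
    rw [hP]; fun_prop
  have hQd : DifferentiableOn ℂ Q (ball 0 R) := hf.sub hPdiff.differentiableOn
  have htailQ : ∀ z : ℂ, ‖z‖ ≤ R / 4 → ‖Q z‖ ≤ 2 * M * (‖z‖ / (R / 2)) ^ (k + 1) := fun z hz => htail z hz
  have ht0 : (t : ℂ) ≠ 0 := by exact_mod_cast ht.ne'
  have htn : ‖(t : ℂ)‖ = t := by rw [Complex.norm_real, Real.norm_eq_abs, abs_of_pos ht]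
  have hQ' := norm_deriv_tail_le hR (by positivity : (0:ℝ) < R / 2) hQd (k + 1) htailQ ht0 (by rw [htn]; exact htR)
  rw [htn] at hQ'
  -- (iv) `deriv f = P' + deriv Q`
  have hft : HasDerivAt f (deriv f t) t :=
    (hf.differentiableAt (isOpen_ball.mem_nhds (by rw [mem_ball, dist_zero_right, htn]; linarith))).hasDerivAt
  have hQt : HasDerivAt Q (deriv f t - ∑ n ∈ Finset.range (k + 1), a n * ((n : ℂ) * (t : ℂ) ^ (n - 1))) t :=
    hft.sub hPd
  have hderQ : deriv Q t = deriv f t - ∑ n ∈ Finset.range (k + 1), a n * ((n : ℂ) * (t : ℂ) ^ (n - 1)) := hQt.deriv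
  have hkey : (deriv f t).re - k * c * t ^ (k - 1) = (deriv Q t).re := by
    rw [hderQ, Complex.sub_re, hPd_re]
  rw [hkey]
  refine (Complex.abs_re_le_norm _).trans ?_
  have hbound : ‖deriv Q ↑t‖ ≤ 2 * M * (2 * t / (R / 2)) ^ (k + 1) / t := by
    rw [le_div_iff₀ ht]; exact hQ'
  refine hbound.trans (le_of_eq ?_)
  rw [div_pow, mul_pow, pow_succ (2 : ℝ) (k + 1), pow_succ t k]
  field_simp

end Summit.QuantumFields.YangMills.Cruxes.NT.StrongCouplingRung.AnalyticJet

end
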